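import Summits.QuantumFields.YangMills.Theorems.UnitScaleTiltProp7LemmaHCurvedOfPairRow
import HarnessLib

/-!
# Route `UnitScaleTilt`, crux K1 «MinimiserStabilityRegPr» (stmt-QuantumFields-19200), route-R E′ path (α′), row LEMMA-H-CURVED — FILE 6c (numbers):
# LEMMA-H-CURVED IN `d = 3` WITH (3.35)-TYPE FRAME ROWS `a₀ = C₀e∕ℓ`, `a₁ = C₁e∕ℓ²`: ABSOLUTE CONSTANTS, `k`-UNIFORM

Cell `ym3-torus`, D-0154 (3c) twin-width seat `ym-routeR-w1` (gen 5); row "routeR-w1 g5: LEMMA-H-CURVED" (namer ★ym-ust-19200-p1 g14∕g15; design of record (x2′-corner)).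
THEOREMS ONLY (0 `def`, 0 `sorry`); `--supports stmt-QuantumFields-19200`, count-neutral.  YM₃ on T³ is a ladder rung (R3), not the Clay problem; nothing here claims a stub,
the crux, d = 4 or the mass gap.

WHAT.  ✓ `Prop7LemmaHCurvedOfPairRow.lemmaH_curved_of_pairRow` read with the frame rows in their (3.35) sizes `a₀ = C₀e∕ℓ`, `a₁ = C₁e∕ℓ²` (`ℓ = L^(K−n) ≥ L ≥ 3`, `0 ≤ e ≤ 1`):
★★★ `lemmaH_curved_d3`:
  `L^(K−n)·Σ_x ‖Δ_Wψ(x)‖²_HS ≤ (216(C₁ + 2C₀²)² + 8989056·C₀²)·e²·Σ_y ‖ψ(c_y) − c_y‖² + 62208·Σ_y D_y²`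
— every `ℓ` has cancelled: the slack is `O(e²)` in the currency `Σ_y‖ψ(c_y) − c_y‖²` (`c_y` any central field; per ★p1 g15 (2)(e) the call site books it in K-form) and the data
term is an absolute multiple of the pair row's `Σ_y D_y²`.
HOW.  `arith_d3` (the real-number identity∕estimate behind the cancellation, `field_simp; ring` + two monotonicity steps), `sum_sq_add_le` (`Σ(D + t·n)² ≤ 2ΣD² + 2t²Σn²`), assembly.
HONEST SCOPE.  Arithmetic only; the frame rows and the pair row stay hypotheses.

References: T. Bałaban, CMP 99 (1985) 389–434 [Balaban1985BackgroundPropagators] ((3.35) p.396, Thm 3.11 p.416); CMP 102 (1985) 277–309 [Balaban1985Variational] (Prop. 7 p.299).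
-/

set_option autoImplicit false

noncomputable section

open scoped BigOperators Matrix.Norms.L2Operator Matrix

namespace Summit.QuantumFields.YangMills.Theorems.Prop7LemmaHCurvedD3

open Literature.MathematicalPhysics.QuantumFieldTheory.Balaban1983to89
open Literature.MathematicalPhysics.QuantumFieldTheory.Balaban1983to89.T3ContinuumYM3Torus
open B9Eq39Adjoint (R covD divB)
open B9TorusCalculus (torusT)
open B10Eq27TorusAxialLog (unitsField toUField)
open B5Eq118OneStroke (iterBlockOf)
open B15DeterminingSets (embIter)
open Summit.QuantumFields.YangMills.Theorems.Prop7LemmaHCurvedOfPairRow (lemmaH_curved_of_pairRow)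

/-! ## §1 Arithmetic -/

/-- `Σ_y (D_y + t·n_y)² ≤ 2Σ_y D_y² + 2t²Σ_y n_y²`. [folklore] -/
theorem sum_sq_add_le {Y : Type*} [Fintype Y] (D n : Y → ℝ) (t : ℝ) :
    ∑ y, (D y + t * n y) ^ 2 ≤ 2 * ∑ y, D y ^ 2 + 2 * t ^ 2 * ∑ y, n y ^ 2 := by
  have h : ∀ y, (D y + t * n y) ^ 2 ≤ 2 * D y ^ 2 + 2 * t ^ 2 * n y ^ 2 := fun y => by nlinarith [sq_nonneg (D y - t * n y)]
  calc ∑ y, (D y + t * n y) ^ 2 ≤ ∑ y, (2 * D y ^ 2 + 2 * t ^ 2 * n y ^ 2) := Finset.sum_le_sum fun y _ => h y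
    _ = 2 * ∑ y, D y ^ 2 + 2 * t ^ 2 * ∑ y, n y ^ 2 := by rw [Finset.sum_add_distrib, ← Finset.mul_sum, ← Finset.mul_sum]

/-- the cancellation of `ℓ` in the LEMMA-H-curved bound at `d = 3`, `a₀ = C₀e∕ℓ`, `a₁ = C₁e∕ℓ²`. [folklore] -/
theorem arith_d3 {ℓ e C₀ C₁ M SD S : ℝ} (hℓ : 0 < ℓ) (he0 : 0 ≤ e) (he1 : e ≤ 1) (hC₁ : 0 ≤ C₁) (hM : 0 ≤ M)
    (hS : S ≤ 2 * SD + 2 * (12 * C₀ * e) ^ 2 * M) :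
    ℓ * (2 * ((3 * (2 * (3 : ℝ) * (C₁ * e / ℓ ^ 2 + 2 * (C₀ * e / ℓ) ^ 2)) ^ 2 * ℓ ^ 3
        + 48 * (3 : ℝ) ^ 2 * (C₀ * e / ℓ) ^ 2 * (6 / ℓ) * (6 / ℓ * ℓ ^ 3)) * M
        + 3 * (3 : ℝ) ^ 2 * (24 / ℓ ^ 2) * (24 / ℓ ^ 2 * ℓ ^ 3) * S))
      ≤ (216 * (C₁ + 2 * C₀ ^ 2) ^ 2 + 8989056 * C₀ ^ 2) * e ^ 2 * M + 62208 * SD := by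
  have hℓ0 : ℓ ≠ 0 := hℓ.ne'
  have e1 : ℓ * (2 * ((3 * (2 * (3 : ℝ) * (C₁ * e / ℓ ^ 2 + 2 * (C₀ * e / ℓ) ^ 2)) ^ 2 * ℓ ^ 3
        + 48 * (3 : ℝ) ^ 2 * (C₀ * e / ℓ) ^ 2 * (6 / ℓ) * (6 / ℓ * ℓ ^ 3)) * M
        + 3 * (3 : ℝ) ^ 2 * (24 / ℓ ^ 2) * (24 / ℓ ^ 2 * ℓ ^ 3) * S))
      = (216 * (C₁ * e + 2 * C₀ ^ 2 * e ^ 2) ^ 2 + 31104 * C₀ ^ 2 * e ^ 2) * M + 31104 * S := by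
    field_simp
    ring
  rw [e1]
  have h1' : 0 ≤ C₁ * e + 2 * C₀ ^ 2 * e ^ 2 := by positivity
  have h1 : C₁ * e + 2 * C₀ ^ 2 * e ^ 2 ≤ (C₁ + 2 * C₀ ^ 2) * e := by nlinarith [mul_nonneg (sq_nonneg C₀) he0]
  have hsq : (C₁ * e + 2 * C₀ ^ 2 * e ^ 2) ^ 2 ≤ (C₁ + 2 * C₀ ^ 2) ^ 2 * e ^ 2 := by
    rw [← mul_pow]; exact pow_le_pow_left₀ h1' h1 2
  have t1 : 216 * (C₁ * e + 2 * C₀ ^ 2 * e ^ 2) ^ 2 * M ≤ 216 * ((C₁ + 2 * C₀ ^ 2) ^ 2 * e ^ 2) * M :=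
    mul_le_mul_of_nonneg_right (mul_le_mul_of_nonneg_left hsq (by norm_num)) hM
  have t2 : 31104 * S ≤ 31104 * (2 * SD + 2 * (12 * C₀ * e) ^ 2 * M) := mul_le_mul_of_nonneg_left hS (by norm_num)
  nlinarith [t1, t2]

/-! ## §2 LEMMA-H-curved at `d = 3` with (3.35)-type frame rows -/

/-- ★★★ **LEMMA-H-CURVED, `d = 3`, (3.35)-TYPE ROWS, ABSOLUTE CONSTANTS** (see the module docstring).
[cite: Balaban1985BackgroundPropagators, (3.35) p.396, Thm 3.11 p.416; Balaban1985Variational, Prop. 7 p.299] -/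
theorem lemmaH_curved_d3 (F : T3Family) (K n : ℕ) (hk : K - n ≤ (F.P K).m + (F.P K).K) (hKn : 1 ≤ K - n)
    (W : GaugeField (F.P K) 0 (Matrix.specialUnitaryGroup (Fin 2) ℂ)) (ψ : Site (F.P K) 0 → Matrix (Fin 2) (Fin 2) ℂ)
    (hψ : ∀ x : Site (F.P K) 0, x ∉ Set.range (embIter (K - n)) →
      divB (torusT (F.P K) 0) (fun κ z => unitsField (toUField W) ⟨z, κ⟩) (fun κ y => covD (torusT (F.P K) 0) (fun κ z => unitsField (toUField W) ⟨z, κ⟩) κ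
        (fun z => divB (torusT (F.P K) 0) (fun κ z => unitsField (toUField W) ⟨z, κ⟩)
          (fun ν w => covD (torusT (F.P K) 0) (fun κ z => unitsField (toUField W) ⟨z, κ⟩) ν ψ w) z) y) x = 0)
    (Fr : Site (F.P K) (K - n) → Site (F.P K) 0 → (Matrix (Fin 2) (Fin 2) ℂ)ˣ)
    (hFr : ∀ y z, ‖(Fr y z : Matrix (Fin 2) (Fin 2) ℂ)‖ ≤ 1 ∧ ‖(((Fr y z)⁻¹ : (Matrix (Fin 2) (Fin 2) ℂ)ˣ) : Matrix (Fin 2) (Fin 2) ℂ)‖ ≤ 1)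
    (hFr1 : ∀ y, Fr y (embIter (K - n) y) = 1)
    (c : Site (F.P K) (K - n) → Matrix (Fin 2) (Fin 2) ℂ) (hc : ∀ y (a : Matrix (Fin 2) (Fin 2) ℂ), Commute (c y) a)
    {e C₀ C₁ : ℝ} (he0 : 0 ≤ e) (he1 : e ≤ 1) (hC₀ : 0 ≤ C₀) (hC₁ : 0 ≤ C₁)
    (hA : ∀ (y : Site (F.P K) (K - n)) (z : Site (F.P K) 0),
      (∀ ν : Fin (F.P K).d, (y ν = (iterBlockOf (K - n) (fun κ => z κ - (((((F.P K).L ^ (K - n) - 1) / 2 : ℕ)) : ZMod ((F.P K).sitesPerDir 0)))) ν - 1 ∨ y ν = (iterBlockOf (K - n) (fun κ => z κ - (((((F.P K).L ^ (K - n) - 1) / 2 : ℕ)) : ZMod ((F.P K).sitesPerDir 0)))) ν ∨ y ν = (iterBlockOf (K - n) (fun κ => z κ - (((((F.P K).L ^ (K - n) - 1) / 2 : ℕ)) : ZMod ((F.P K).sitesPerDir 0)))) ν + 1 ∨ y ν = (iterBlockOf (K - n) (fun κ => z κ - (((((F.P K).L ^ (K - n) - 1) / 2 : ℕ)) : ZMod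 ((F.P K).sitesPerDir 0)))) ν + 2)) →
      ∀ μ : Fin (F.P K).d,
        ‖(((Fr y z)⁻¹ * unitsField (toUField W) ⟨z, μ⟩ * Fr y (torusT (F.P K) 0 μ z) : (Matrix (Fin 2) (Fin 2) ℂ)ˣ) : Matrix (Fin 2) (Fin 2) ℂ) - 1‖
            ≤ C₀ * e / (F.L : ℝ) ^ (K - n)
        ∧ ‖(((Fr y ((torusT (F.P K) 0 μ).symm z))⁻¹ * unitsField (toUField W) ⟨(torusT (F.P K) 0 μ).symm z, μ⟩ * Fr y z : (Matrix (Fin 2) (Fin 2) ℂ)ˣ) :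
            Matrix (Fin 2) (Fin 2) ℂ) - 1‖ ≤ C₀ * e / (F.L : ℝ) ^ (K - n)
        ∧ ‖(((Fr y z)⁻¹ * unitsField (toUField W) ⟨z, μ⟩ * Fr y (torusT (F.P K) 0 μ z) : (Matrix (Fin 2) (Fin 2) ℂ)ˣ) : Matrix (Fin 2) (Fin 2) ℂ)
            - (((Fr y ((torusT (F.P K) 0 μ).symm z))⁻¹ * unitsField (toUField W) ⟨(torusT (F.P K) 0 μ).symm z, μ⟩ * Fr y z : (Matrix (Fin 2) (Fin 2) ℂ)ˣ) :
              Matrix (Fin 2) (Fin 2) ℂ)‖ ≤ C₁ * e / ((F.L : ℝ) ^ (K - n)) ^ 2)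
    (D : Site (F.P K) (K - n) → ℝ)
    (hD : ∀ (y y₀ : Site (F.P K) (K - n)), (∀ ν : Fin (F.P K).d, (y ν = y₀ ν - 1 ∨ y ν = y₀ ν ∨ y ν = y₀ ν + 1 ∨ y ν = y₀ ν + 2)) →
      ‖R (Fr y (embIter (K - n) y₀)) (ψ (embIter (K - n) y)) - ψ (embIter (K - n) y₀)‖ ≤ D y) :
    (F.L : ℝ) ^ (K - n) * ∑ x : Site (F.P K) 0, ∑ a : Fin 2, ∑ b : Fin 2,
        Complex.normSq ((divB (torusT (F.P K) 0) (fun κ z => unitsField (toUField W) ⟨z, κ⟩)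
          (fun κ y => covD (torusT (F.P K) 0) (fun κ z => unitsField (toUField W) ⟨z, κ⟩) κ ψ y) x) a b)
      ≤ (216 * (C₁ + 2 * C₀ ^ 2) ^ 2 + 8989056 * C₀ ^ 2) * e ^ 2 * ∑ y : Site (F.P K) (K - n), ‖ψ (embIter (K - n) y) - c y‖ ^ 2
        + 62208 * ∑ y : Site (F.P K) (K - n), D y ^ 2 := by
  have hL1 : 1 < F.L := F.hL.2
  have hℓ2 : 2 ≤ (F.P K).L ^ (K - n) := by
    show 2 ≤ F.L ^ (K - n)
    calc 2 ≤ F.L := hL1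
      _ = F.L ^ 1 := (pow_one _).symm
      _ ≤ F.L ^ (K - n) := Nat.pow_le_pow_right (by omega) hKn
  have hℓR : (0 : ℝ) < (F.L : ℝ) ^ (K - n) := by positivity
  have ha₀ : 0 ≤ C₀ * e / (F.L : ℝ) ^ (K - n) := by positivity
  have h := lemmaH_curved_of_pairRow F K n hk hℓ2 W ψ hψ Fr hFr hFr1 c hc ha₀ (C₁ * e / ((F.L : ℝ) ^ (K - n)) ^ 2) hA D hD
  have eℓ : (((F.P K).L ^ (K - n) : ℕ) : ℝ) = (F.L : ℝ) ^ (K - n) := by rw [Nat.cast_pow]; rfl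
  rw [eℓ] at h
  simp only [T3Family.P_d, Nat.cast_ofNat] at h
  refine h.trans ?_
  have hS := sum_sq_add_le D (fun y => ‖ψ (embIter (K - n) y) - c y‖) (2 * (3 * ((F.L : ℝ) ^ (K - n) * (C₀ * e / (F.L : ℝ) ^ (K - n) + C₀ * e / (F.L : ℝ) ^ (K - n)))))
  have et : (2 * (3 * ((F.L : ℝ) ^ (K - n) * (C₀ * e / (F.L : ℝ) ^ (K - n) + C₀ * e / (F.L : ℝ) ^ (K - n))))) = 12 * C₀ * e := by
    field_simp; ring
  have hS' := hS.trans (le_of_eq (by rw [et]))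
  exact arith_d3 hℓR he0 he1 hC₁ (Finset.sum_nonneg fun y _ => sq_nonneg _) hS'

end Summit.QuantumFields.YangMills.Theorems.Prop7LemmaHCurvedD3

end
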